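import Literature.NumberTheory.NumberFields.AmbiguousClassNumberPrimeDegreeAnyPrime
import HarnessLib

/-!
# Chevalley's doors in prime degree from a LOWER BOUND on the unit norm index only:
# `p^{s-1} ∣ [E_K : E_K ∩ N_{L/K} Lˣ]` with at most `s` ramified primes ⟹ `#Cl(L)^G ∣ h_K`; door U and door UG

Topic `NumberTheory/NumberFields`; namespace `Literature.NumberTheory.NumberFields.AmbiguousClass`.  THEOREMS ONLY
(no definition, no named fact, no instance, no `sorry`).  Sequel of `AmbiguousClassNumberPrimeDegreeAnyPrime.lean`.

The unit-norm-index doors of the tree (`IwasawaTheory/ClassicalMuVanishesUnitNormIndex{,Generated}.lean` for `p` odd,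
`AmbiguousClassNumberPrimeDegreeAnyPrime.lean` for every prime under `[IsUnramifiedAtInfinitePlaces K L]`) ask for the
EXACT unit norm index `[E_K : E_K ∩ N_{L/K} Lˣ] · p = p^s` together with the exact number `s` of ramified primes.  A
per-field certificate, however, naturally proves only a LOWER bound: `r` units of `K` whose `2^r` (resp. `p^r`) products
are pairwise incongruent modulo norms give `p^r ∣ [E_K : E_K ∩ N Lˣ]` (tree: `two_dvd_relIndex_of_nonNorm`,
`four_dvd_relIndex_unitsNorm_of_not_mem`), while the matching UPPER bound `[E_K : E_K ∩ N Lˣ] ≤ p^{t-1}` is the Hasse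
norm theorem, not in the tree.  This file shows that the lower bound suffices, for every prime degree `p`:

* `card_fixed_dvd_classNumber_of_pow_dvd_relIndex_mul` — `L/K` Galois of prime degree `p`, unramified at infinity, AT
  MOST `s` ramified primes, `p^s ∣ [E_K : E_K ∩ N Lˣ] · p` (i.e. `p^{s-1} ∣` the index) ⟹ `#Cl(L)^G ∣ h_K` (Chevalley:
  `#Cl(L)^G · p · [E_K : …] = h_K · p^t`, `t ≤ s`);
* `not_dvd_classNumber_of_pow_dvd_relIndex_mul` — door U: moreover `p ∤ h_K` ⟹ `p ∤ h_L`;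
* `classNumber_le_card_fixed_of_sup_eq_top` — NO archimedean / unit hypothesis: if the classes of the ramified primes
  generate `Cl(K)` modulo `p`-th powers then `N_{L/K}` maps `Cl(L)^G` ONTO `Cl(K)`, so `h_K ≤ #Cl(L)^G`;
* `card_fixed_eq_classNumber_of_pow_dvd_relIndex_mul_of_sup_eq_top` — hence `#Cl(L)^G = h_K` from the lower bound and
  the generation hypothesis (and then necessarily `t = s` and the index IS `p^{s-1}`: the upper bound comes for free);
* **`padicValNat_classNumber_eq_of_pow_dvd_relIndex_mul_of_sup_eq_top`** — door UG: `ord_p h_L = ord_p h_K` (via the core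
  `padicValNat_classNumber_eq_of_card_fixed_eq_classNumber_of_sup_eq_top`), and its `p`-primary form
  `…_of_torsion_le_closure`.

HONEST SCOPE: classical genus theory after Chevalley's ambiguous class number formula (Lang Ch. 13 §4, Gras IV.4);
nothing specific to any summit; BSD is not advanced by this file.

## References

* S. Lang, *Cyclotomic Fields I and II*, GTM 121 (1990), Ch. 13 §4, Lemma 4.1 and the paragraph after it (held copy,
  PDF pp. 203–204); tree theorem `AmbiguousClass.ambiguousClassNumberFormula`. [Lang1990]
* G. Gras, *Class Field Theory* (2003), II.6.2.3, IV.4 (genus theory: invariant classes, the genus exact sequence). [Gras2003]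
* J. Neukirch, *Algebraic Number Theory* (1999), Ch. III §1 Prop. (1.6) (ii), (iv). [NeukirchANT1999]
-/

noncomputable section

open NumberField IsDedekindDomain
open scoped nonZeroDivisors

namespace Literature.NumberTheory.NumberFields.AmbiguousClass

open Literature.NumberTheory.GaloisRepresentations Literature.NumberTheory.GaloisRepresentations.Herbrand
  Literature.NumberTheory.GaloisRepresentations.MinkowskiUnit
  Literature.NumberTheory.GaloisRepresentations.CyclicNormIndex

variable {K L : Type} [Field K] [NumberField K] [Field L] [NumberField L] [Algebra K L]

/-- **`#Cl(L)^G ∣ h_K` from a lower bound on the unit norm index.**  Let `L/K` be Galois of prime degree `p`,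
unramified at the infinite places, with at most `s` ramified primes (each totally ramified: `∏_𝔭 e_𝔭 = p^t`, `t ≤ s`)
and `p^s ∣ [E_K : E_K ∩ N_{L/K} Lˣ] · p`.  Chevalley's formula `#Cl(L)^G · p · [E_K : …] = h_K · p^t`
(`ambiguousClassNumberFormula`, `archFactor_eq_one`) then gives `#Cl(L)^G · k · p^{s-t} = h_K`, so `#Cl(L)^G ∣ h_K`.
[cite: Lang1990, Ch. 13 §4, Lemma 4.1 (PDF p. 203)] -/
theorem card_fixed_dvd_classNumber_of_pow_dvd_relIndex_mul [IsGalois K L] [IsUnramifiedAtInfinitePlaces K L]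
    {p : ℕ} (hp : p.Prime) (hdeg : Module.finrank K L = p) {s : ℕ}
    (hs : {v : HeightOneSpectrum (𝓞 K) | v.asIdeal.ramificationIdxIn (𝓞 L) ≠ 1}.ncard ≤ s)
    (hidx : p ^ s ∣ (unitsE L ⊓ (⊤ : Subgroup Lˣ).map (Herbrand.norm (L ≃ₐ[K] L))).relIndex
        (unitsE L ⊓ (unitsIncl K L).range) * p) :
    Nat.card {c : ClassGroup (𝓞 L) // ∀ τ : L ≃ₐ[K] L, ClassGroup.mulEquiv (intAut τ) c = c} ∣
      classNumber K := by
  classical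
  haveI : FiniteDimensional K L := Module.Finite.of_restrictScalars_finite ℚ K L
  have hcard : Nat.card (L ≃ₐ[K] L) = p := by rw [IsGalois.card_aut_eq_finrank, hdeg]
  haveI : Fact p.Prime := ⟨hp⟩
  haveI : IsCyclic (L ≃ₐ[K] L) := isCyclic_of_prime_card hcard
  obtain ⟨σ, hσ⟩ := IsCyclic.exists_generator (α := L ≃ₐ[K] L)
  have h := ambiguousClassNumberFormula hσ
  rw [archFactor_eq_one, mul_one, finprod_ramificationIdxIn_eq_pow_of_prime hp hdeg, hdeg, mul_assoc] at h
  set t := {v : HeightOneSpectrum (𝓞 K) | v.asIdeal.ramificationIdxIn (𝓞 L) ≠ 1}.ncard with ht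
  set F := Nat.card {c : ClassGroup (𝓞 L) // ∀ τ : L ≃ₐ[K] L, ClassGroup.mulEquiv (intAut τ) c = c}
    with hF
  -- `p · idx = p^s · k`, `s = t + d`
  obtain ⟨k, hk⟩ := hidx
  obtain ⟨d, hd⟩ := Nat.exists_eq_add_of_le hs
  rw [mul_comm _ p] at hk
  rw [hk, hd, pow_add] at h
  -- `F · (p^t · p^d · k) = h_K · p^t`
  have hpt : 0 < p ^ t := pow_pos hp.pos t
  refine ⟨p ^ d * k, ?_⟩
  have h2 : F * (p ^ d * k) * p ^ t = classNumber K * p ^ t := by rw [← h]; ring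
  exact (Nat.eq_of_mul_eq_mul_right hpt h2).symm

/-- **Door U from a lower bound on the unit norm index: `p ∤ h_L`.**  `L/K` Galois of prime degree `p`, unramified
at the infinite places, `p ∤ h_K`, at most `s` ramified primes and `p^s ∣ [E_K : E_K ∩ N_{L/K} Lˣ] · p`: then
`p ∤ h_L` (`#Cl(L)^G ∣ h_K` is prime to `p`; fixed-point congruence `not_dvd_classNumber_of_isPGroup_of_not_dvd_card_fixed`).
For `p = 2`: `s - 1` units of `K` with pairwise non-congruent products modulo `N Lˣ` certify the hypothesis — no upper
bound on the index is needed. [cite: Lang1990, Ch. 13 §4, Lemma 4.1 (PDF p. 203)] -/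
theorem not_dvd_classNumber_of_pow_dvd_relIndex_mul [IsGalois K L] [IsUnramifiedAtInfinitePlaces K L]
    {p : ℕ} (hp : p.Prime) (hdeg : Module.finrank K L = p) (hK : ¬ p ∣ classNumber K) {s : ℕ}
    (hs : {v : HeightOneSpectrum (𝓞 K) | v.asIdeal.ramificationIdxIn (𝓞 L) ≠ 1}.ncard ≤ s)
    (hidx : p ^ s ∣ (unitsE L ⊓ (⊤ : Subgroup Lˣ).map (Herbrand.norm (L ≃ₐ[K] L))).relIndex
        (unitsE L ⊓ (unitsIncl K L).range) * p) :
    ¬ p ∣ classNumber L := by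
  haveI : FiniteDimensional K L := Module.Finite.of_restrictScalars_finite ℚ K L
  haveI : Fact p.Prime := ⟨hp⟩
  have hG : IsPGroup p (L ≃ₐ[K] L) :=
    IsPGroup.of_card (n := 1) (by rw [pow_one, IsGalois.card_aut_eq_finrank, hdeg])
  refine not_dvd_classNumber_of_isPGroup_of_not_dvd_card_fixed hG fun hdvd => hK ?_
  exact hdvd.trans (card_fixed_dvd_classNumber_of_pow_dvd_relIndex_mul hp hdeg hs hidx)

/-- **`h_K ≤ #Cl(L)^G` from the generation hypothesis alone.**  Let `L/K` be Galois of prime degree `p` and suppose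
the classes of the primes of `K` ramified in `L` generate `Cl(K)` modulo `p`-th powers.  Then `N_{L/K}` maps the
ambiguous classes ONTO `Cl(K)` (the ambiguous class of the prime above a ramified `𝔭` has norm `[𝔭]`,
`exists_fixed_class_norm_eq_of_ramificationIdxIn_ne_one`; `N(i d) = d^p`, `classGroupNorm_classGroupExtend`; extended
classes are ambiguous, `mulEquiv_intAut_classGroupExtend`), so `h_K ≤ #Cl(L)^G`.  No archimedean and no unit
hypothesis. [folklore] [cite: NeukirchANT1999, Ch. III §1 Prop. (1.6) (ii), (iv)]
[cite: Lang1990, Ch. 13 §4, Lemma 4.1 and sequel (PDF pp. 203–204)] -/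
theorem classNumber_le_card_fixed_of_sup_eq_top [IsGalois K L] {p : ℕ} (hp : p.Prime)
    (hdeg : Module.finrank K L = p)
    (hgen : Subgroup.closure {c : ClassGroup (𝓞 K) | ∃ v : HeightOneSpectrum (𝓞 K),
        v.asIdeal.ramificationIdxIn (𝓞 L) ≠ 1 ∧
          c = ClassGroup.mk0 ⟨v.asIdeal, mem_nonZeroDivisors_of_ne_zero v.ne_bot⟩} ⊔
      (powMonoidHom p : ClassGroup (𝓞 K) →* ClassGroup (𝓞 K)).range = ⊤) :
    classNumber K ≤
      Nat.card {c : ClassGroup (𝓞 L) // ∀ τ : L ≃ₐ[K] L, ClassGroup.mulEquiv (intAut τ) c = c} := by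
  classical
  haveI : FiniteDimensional K L := Module.Finite.of_restrictScalars_finite ℚ K L
  -- the norm maps the ambiguous classes ONTO `Cl(K)`
  have hNsurj : ∀ a : ClassGroup (𝓞 K), ∃ m : ClassGroup (𝓞 L),
      (∀ τ : L ≃ₐ[K] L, ClassGroup.mulEquiv (intAut τ) m = m) ∧ classGroupNorm K L m = a := by
    intro a
    have ha : a ∈ Subgroup.closure {c : ClassGroup (𝓞 K) | ∃ v : HeightOneSpectrum (𝓞 K),
        v.asIdeal.ramificationIdxIn (𝓞 L) ≠ 1 ∧
          c = ClassGroup.mk0 ⟨v.asIdeal, mem_nonZeroDivisors_of_ne_zero v.ne_bot⟩} ⊔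
      (powMonoidHom p : ClassGroup (𝓞 K) →* ClassGroup (𝓞 K)).range := by
      rw [hgen]; exact Subgroup.mem_top a
    obtain ⟨b, hb, c, hc, rfl⟩ := Subgroup.mem_sup.mp ha
    clear ha
    have hb' : ∃ m : ClassGroup (𝓞 L), (∀ τ : L ≃ₐ[K] L, ClassGroup.mulEquiv (intAut τ) m = m) ∧
        classGroupNorm K L m = b := by
      induction hb using Subgroup.closure_induction with
      | mem x hx =>
        obtain ⟨v, hv, rfl⟩ := hx
        exact exists_fixed_class_norm_eq_of_ramificationIdxIn_ne_one hp hdeg hv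
      | one => exact ⟨1, fun τ => map_one _, map_one _⟩
      | mul x y _ _ ihx ihy =>
        obtain ⟨m₁, hm₁, rfl⟩ := ihx
        obtain ⟨m₂, hm₂, rfl⟩ := ihy
        exact ⟨m₁ * m₂, fun τ => by rw [map_mul, hm₁ τ, hm₂ τ], map_mul _ _ _⟩
      | inv x _ ihx =>
        obtain ⟨m, hm, rfl⟩ := ihx
        exact ⟨m⁻¹, fun τ => by rw [map_inv, hm τ], map_inv _ _⟩
    obtain ⟨d, rfl⟩ := hc
    obtain ⟨m, hm, rfl⟩ := hb'
    refine ⟨m * classGroupExtend K L d, fun τ => by rw [map_mul, hm τ, mulEquiv_intAut_classGroupExtend], ?_⟩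
    rw [map_mul, classGroupNorm_classGroupExtend, hdeg, powMonoidHom_apply]
  -- hence `h_K ≤ #Cl(L)^G`
  set NH : {c : ClassGroup (𝓞 L) // ∀ τ : L ≃ₐ[K] L, ClassGroup.mulEquiv (intAut τ) c = c} →
      ClassGroup (𝓞 K) := fun c => classGroupNorm K L c.1 with hNH
  have hsurj : Function.Surjective NH := fun a => by
    obtain ⟨m, hm, rfl⟩ := hNsurj a
    exact ⟨⟨m, hm⟩, rfl⟩
  rw [classNumber, ← Nat.card_eq_fintype_card]
  exact Nat.card_le_card_of_surjective NH hsurj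

/-- **`#Cl(L)^G = h_K` from the lower bound and the generation hypothesis.**  `L/K` Galois of prime degree `p`,
unramified at the infinite places, at most `s` ramified primes, `p^s ∣ [E_K : E_K ∩ N_{L/K} Lˣ] · p`, and ramified
classes generating `Cl(K)` modulo `p`-th powers: then `#Cl(L)^G ∣ h_K` and `h_K ≤ #Cl(L)^G`, so `#Cl(L)^G = h_K`
(and, a posteriori, exactly `s` primes ramify and the index is exactly `p^{s-1}` — the Hasse-norm-theorem upper bound
is not needed as an input). [folklore] [cite: Lang1990, Ch. 13 §4, Lemma 4.1 and sequel (PDF pp. 203–204)] -/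
theorem card_fixed_eq_classNumber_of_pow_dvd_relIndex_mul_of_sup_eq_top [IsGalois K L]
    [IsUnramifiedAtInfinitePlaces K L] {p : ℕ} (hp : p.Prime) (hdeg : Module.finrank K L = p) {s : ℕ}
    (hs : {v : HeightOneSpectrum (𝓞 K) | v.asIdeal.ramificationIdxIn (𝓞 L) ≠ 1}.ncard ≤ s)
    (hidx : p ^ s ∣ (unitsE L ⊓ (⊤ : Subgroup Lˣ).map (Herbrand.norm (L ≃ₐ[K] L))).relIndex
        (unitsE L ⊓ (unitsIncl K L).range) * p)
    (hgen : Subgroup.closure {c : ClassGroup (𝓞 K) | ∃ v : HeightOneSpectrum (𝓞 K),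
        v.asIdeal.ramificationIdxIn (𝓞 L) ≠ 1 ∧
          c = ClassGroup.mk0 ⟨v.asIdeal, mem_nonZeroDivisors_of_ne_zero v.ne_bot⟩} ⊔
      (powMonoidHom p : ClassGroup (𝓞 K) →* ClassGroup (𝓞 K)).range = ⊤) :
    Nat.card {c : ClassGroup (𝓞 L) // ∀ τ : L ≃ₐ[K] L, ClassGroup.mulEquiv (intAut τ) c = c} =
      classNumber K :=
  le_antisymm
    (Nat.le_of_dvd (Nat.pos_of_ne_zero Fintype.card_ne_zero)
      (card_fixed_dvd_classNumber_of_pow_dvd_relIndex_mul hp hdeg hs hidx))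
    (classNumber_le_card_fixed_of_sup_eq_top hp hdeg hgen)

/-- **Door UG from a lower bound on the unit norm index — `ord_p h_L = ord_p h_K`.**  `L/K` Galois of ANY prime
degree `p`, unramified at the infinite places, at most `s` ramified primes, `p^s ∣ [E_K : E_K ∩ N_{L/K} Lˣ] · p`, and
ramified classes generating `Cl(K)` modulo `p`-th powers: then `ord_p h_L = ord_p h_K` (`#Cl(L)^G = h_K` by
`card_fixed_eq_classNumber_of_pow_dvd_relIndex_mul_of_sup_eq_top`, then the core
`padicValNat_classNumber_eq_of_card_fixed_eq_classNumber_of_sup_eq_top`).  For `p = 2`, `s - 1` units with pairwise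
non-congruent products modulo `N Lˣ` certify `hidx`. [folklore]
[cite: Lang1990, Ch. 13 §4, Lemma 4.1 and sequel (PDF pp. 203–204)] -/
theorem padicValNat_classNumber_eq_of_pow_dvd_relIndex_mul_of_sup_eq_top [IsGalois K L]
    [IsUnramifiedAtInfinitePlaces K L] {p : ℕ} (hp : p.Prime) (hdeg : Module.finrank K L = p) {s : ℕ}
    (hs : {v : HeightOneSpectrum (𝓞 K) | v.asIdeal.ramificationIdxIn (𝓞 L) ≠ 1}.ncard ≤ s)
    (hidx : p ^ s ∣ (unitsE L ⊓ (⊤ : Subgroup Lˣ).map (Herbrand.norm (L ≃ₐ[K] L))).relIndex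
        (unitsE L ⊓ (unitsIncl K L).range) * p)
    (hgen : Subgroup.closure {c : ClassGroup (𝓞 K) | ∃ v : HeightOneSpectrum (𝓞 K),
        v.asIdeal.ramificationIdxIn (𝓞 L) ≠ 1 ∧
          c = ClassGroup.mk0 ⟨v.asIdeal, mem_nonZeroDivisors_of_ne_zero v.ne_bot⟩} ⊔
      (powMonoidHom p : ClassGroup (𝓞 K) →* ClassGroup (𝓞 K)).range = ⊤) :
    padicValNat p (classNumber L) = padicValNat p (classNumber K) :=
  padicValNat_classNumber_eq_of_card_fixed_eq_classNumber_of_sup_eq_top hp hdeg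
    (card_fixed_eq_classNumber_of_pow_dvd_relIndex_mul_of_sup_eq_top hp hdeg hs hidx hgen) hgen

/-- In a finite commutative group every element is a `p`-power-torsion element times a `p`-th power
(`N = p · #M = p^k · b`, `p ∤ b`, `x p^k + y b = 1`: `c = c^{yb} · (c^{x p^{k-1}})^p`, `(c^{yb})^{p^k} = 1`).
[folklore] -/
private theorem exists_torsion_mul_pow_eq'' {M : Type*} [CommGroup M] [Finite M] {p : ℕ} (hp : p.Prime)
    (c : M) : ∃ a d : M, (∃ n : ℕ, a ^ p ^ n = 1) ∧ a * d ^ p = c := by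
  set N := p * Nat.card M with hN
  have hN0 : N ≠ 0 := mul_ne_zero hp.ne_zero Nat.card_pos.ne'
  set k := N.factorization p with hk
  set b := N / p ^ k with hb
  have hkb : p ^ k * b = N := Nat.ordProj_mul_ordCompl_eq_self N p
  have hcop : Nat.Coprime (p ^ k) b := (Nat.coprime_ordCompl hp hN0).pow_left k
  have hk1 : 1 ≤ k := (hp.dvd_iff_one_le_factorization hN0).mp (dvd_mul_right p _)
  obtain ⟨x, y, hxy⟩ := Nat.isCoprime_iff_coprime.mpr hcop
  refine ⟨c ^ (y * (b : ℤ)), c ^ (x * ((p ^ (k - 1) : ℕ) : ℤ)), ⟨k, ?_⟩, ?_⟩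
  · rw [← zpow_natCast, ← zpow_mul]
    have h : y * (b : ℤ) * ((p ^ k : ℕ) : ℤ) = y * (p : ℤ) * (Nat.card M : ℤ) := by
      rw [mul_assoc, mul_comm (b : ℤ), ← Nat.cast_mul, hkb, hN, Nat.cast_mul, mul_assoc]
    rw [h, zpow_mul, zpow_natCast, pow_card_eq_one']
  · rw [← zpow_natCast (c ^ _) p, ← zpow_mul, ← zpow_add]
    have h : y * (b : ℤ) + x * ((p ^ (k - 1) : ℕ) : ℤ) * (p : ℤ) = 1 := by
      rw [← hxy, mul_assoc x, ← Nat.cast_mul, ← pow_succ, Nat.sub_add_cancel hk1, add_comm]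
    rw [h, zpow_one]

/-- **Door UG from a lower bound on the unit norm index, `p`-primary form** («the `p`-part of `Cl(K)` lies in the
subgroup generated by the classes of the ramified primes»): `L/K` Galois of prime degree `p`, unramified at the
infinite places, at most `s` ramified primes, `p^s ∣ [E_K : E_K ∩ N_{L/K} Lˣ] · p`, and every class of `p`-power order
in the subgroup generated by the ramified classes: then `ord_p h_L = ord_p h_K`. [folklore]
[cite: Lang1990, Ch. 13 §4, Lemma 4.1 and sequel (PDF pp. 203–204)] -/
theorem padicValNat_classNumber_eq_of_pow_dvd_relIndex_mul_of_torsion_le_closure [IsGalois K L]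
    [IsUnramifiedAtInfinitePlaces K L] {p : ℕ} (hp : p.Prime) (hdeg : Module.finrank K L = p) {s : ℕ}
    (hs : {v : HeightOneSpectrum (𝓞 K) | v.asIdeal.ramificationIdxIn (𝓞 L) ≠ 1}.ncard ≤ s)
    (hidx : p ^ s ∣ (unitsE L ⊓ (⊤ : Subgroup Lˣ).map (Herbrand.norm (L ≃ₐ[K] L))).relIndex
        (unitsE L ⊓ (unitsIncl K L).range) * p)
    (hgen : ∀ c : ClassGroup (𝓞 K), (∃ n : ℕ, c ^ p ^ n = 1) →
      c ∈ Subgroup.closure {c : ClassGroup (𝓞 K) | ∃ v : HeightOneSpectrum (𝓞 K),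
        v.asIdeal.ramificationIdxIn (𝓞 L) ≠ 1 ∧
          c = ClassGroup.mk0 ⟨v.asIdeal, mem_nonZeroDivisors_of_ne_zero v.ne_bot⟩}) :
    padicValNat p (classNumber L) = padicValNat p (classNumber K) := by
  refine padicValNat_classNumber_eq_of_pow_dvd_relIndex_mul_of_sup_eq_top hp hdeg hs hidx ?_
  rw [eq_top_iff]
  intro c _
  obtain ⟨a, d, ha, rfl⟩ := exists_torsion_mul_pow_eq'' hp c
  exact Subgroup.mul_mem_sup (hgen a ha) ⟨d, rfl⟩

end Literature.NumberTheory.NumberFields.AmbiguousClass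

end
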